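import Summits.AtomisticToContinuum.BoseEinsteinCondensation.Theses.BECJosephsonSlackThreshold
import Literature.MathematicalPhysics.QuantumManyBody.NeumannMomentumCutoffs

/-!
# Crux `InfraredCapture` (piece 1 of the infrared split of `JosephsonSlackCondensation`, stmt-9780) —
# line `infrared-window`: UV capture by the kinetic gap ∧ vacancy of the phonon window

Skeleton (crux-strategist cstrat-stmt-AtomisticToContinuum-9780). `InfraredCapture` = for small `ρ`
there are `c, κ > 0` such that for EVERY momentum scale `Λ > 0`, eventually in `N`, every
κN/L²-near-minimiser carries `≥ cN` particles in the Neumann modes `u_k 1_Λ`,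
`k ∈ {0} ∪ lowModes(ΛL)` (`|p| ≤ Λ`). The line cuts the momentum axis at ONE large, `(v, ρ)`-dependent
scale `Λ₁` (think `Λ₁ = C√(ρa)`, the inverse healing length):

* `stub_uvCapture` — capture below `Λ₁`: `mass({0} ∪ lowModes(Λ₁L)) ≥ 3N/4` for near-minimisers
  (known technology, size M: the in-tree sum rule `n₀ + n₊^L + n₊^H = N`
  (`NeumannBox.condensateOccupation_add_nPlusLow_add_nPlusHigh`, to be bridged to the `cellOccupation`
  sums), the kinetic gap `(K/L)² n₊^H ≤ T` (`NeumannBox.nPlusHigh_le_mul_lintegral_kineticDensity`) with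
  `K = Λ₁L`, `T ≤ ⟨Ψ,HΨ⟩ ≤ E₀ + κN/L²`, and the Dirichlet upper bound `E₀ ≤ 4πaρN(1+ε)` (route support
  item `DirichletUpperBound`, stmt-9783): `n₊^H ≤ (4πaρ(1+ε) + κ/L²)N/Λ₁² ≤ N/4` for `Λ₁² = 32πaρ`);
* `stub_infraredWindow` — THE HEART: vacancy of the phonon window `(Λ, Λ₁]` up to `wN`, `w < 3/4`,
  uniformly in `Λ ∈ (0, Λ₁]`: `mass({0} ∪ lowModes(Λ₁L)) ≤ mass({0} ∪ lowModes(ΛL)) + wN` for all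
  κN/L²-near-minimisers, eventually in `N` (a Bogoliubov-shape infrared bound
  `n_p ≲ √(ρa)/|p| + slack/p²` summed over the window would give it with `w = O(√(ρa³)) + O(κ)`);
* `infraredCapture_glue` / `InfraredCapture_of` — PROVED composition: `c := 3/4 - w`, `κ := min κ_u κ_w`; for `Λ ≤ Λ₁` cancel
  `ofReal (3N/4) = ofReal ((3/4-w)N) + ofReal (wN)` in `ℝ≥0∞`; for `Λ > Λ₁` the mode family only grows
  (`lowModes` is monotone in the cutoff), so capture below `Λ₁` already suffices.
-/

open Filter MeasureTheory
open scoped ENNReal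

namespace Summit.AtomisticToContinuum.BoseEinsteinCondensation.Cruxes.InfraredCapture.InfraredWindow

open Literature.MathematicalPhysics.QuantumManyBody
open Literature.MathematicalPhysics.QuantumManyBody.BoseGas
open Literature.MathematicalPhysics.QuantumManyBody.NeumannBox
open Summit.AtomisticToContinuum.BoseEinsteinCondensation.Theses.BECJosephsonSlackThreshold

/-! ### Abbreviations (the crux `InfraredCapture` itself is the ROUTE decl, opened above) -/

/-- The infrared mass of an `N`-body function on the box of side `L` below the index cutoff `K`
(momenta `|p| ≤ K/L`): `∑_{k ∈ {0} ∪ lowModes K} ⟨u_k 1_Λ, γ_Ψ u_k 1_Λ⟩`. Local abbreviation. -/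
noncomputable abbrev irMass (K L : ℝ) (N : ℕ) (Ψ : Config N → ℂ) : ℝ≥0∞ :=
  ∑ k ∈ insert (0 : Fin 3 → ℕ) (NeumannBox.lowModes K),
    BoseGas.cellOccupation N L (fun x => ((NeumannBox.mode L k x : ℝ) : ℂ)) Ψ

/-! ### Registered stubs -/

/-- **UV CAPTURE** (stub, size M, known technology): for small `ρ` there are a momentum scale `Λ₁ > 0`
and a slack `κ > 0` such that, eventually in `N`, every κN/L²-near-minimiser carries `≥ 3N/4`
particles at momenta `≤ Λ₁` (sum rule + kinetic gap above `Λ₁ ~ √(ρa)` + Dirichlet energy upper bound). -/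
theorem stub_uvCapture :
    ∀ v : ℝ → ENNReal, BoseGas.IsRepulsiveFiniteRange v → ∃ ρ₀ : ℝ, 0 < ρ₀ ∧ ∀ ρ : ℝ, 0 < ρ → ρ < ρ₀ →
      ∃ Λ₁ κ : ℝ, 0 < Λ₁ ∧ 0 < κ ∧ ∀ᶠ N : ℕ in Filter.atTop,
        ∀ Ψ : BoseGas.TrialState N (BoseGas.sideLength ρ N),
          BoseGas.energy v Ψ ≤ BoseGas.groundStateEnergy v N (BoseGas.sideLength ρ N) +
              ENNReal.ofReal (κ * N / BoseGas.sideLength ρ N ^ 2) →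
            ENNReal.ofReal (3 / 4 * N) ≤
              irMass (Λ₁ * BoseGas.sideLength ρ N) (BoseGas.sideLength ρ N) N Ψ.ψ := by
  sorry

/-- **PHONON-WINDOW VACANCY** (stub, THE HEART, size L/open): for small `ρ` and every UV scale `Λ₁ > 0`
there are a defect `w ∈ [0, 3/4)` and a slack `κ > 0` such that for every `0 < Λ ≤ Λ₁`, eventually in
`N`, the window `(Λ, Λ₁]` of every κN/L²-near-minimiser carries at most `wN`:
`mass(≤ Λ₁) ≤ mass(≤ Λ) + wN`. -/
theorem stub_infraredWindow :
    ∀ v : ℝ → ENNReal, BoseGas.IsRepulsiveFiniteRange v → ∃ ρ₀ : ℝ, 0 < ρ₀ ∧ ∀ ρ : ℝ, 0 < ρ → ρ < ρ₀ →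
      ∀ Λ₁ : ℝ, 0 < Λ₁ → ∃ w κ : ℝ, 0 ≤ w ∧ w < 3 / 4 ∧ 0 < κ ∧ ∀ Λ : ℝ, 0 < Λ → Λ ≤ Λ₁ →
        ∀ᶠ N : ℕ in Filter.atTop, ∀ Ψ : BoseGas.TrialState N (BoseGas.sideLength ρ N),
          BoseGas.energy v Ψ ≤ BoseGas.groundStateEnergy v N (BoseGas.sideLength ρ N) +
              ENNReal.ofReal (κ * N / BoseGas.sideLength ρ N ^ 2) →
            irMass (Λ₁ * BoseGas.sideLength ρ N) (BoseGas.sideLength ρ N) N Ψ.ψ ≤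
              irMass (Λ * BoseGas.sideLength ρ N) (BoseGas.sideLength ρ N) N Ψ.ψ +
                ENNReal.ofReal (w * N) := by
  sorry

/-! ### Proved glue of the line -/

/-- `lowModes` is monotone in the (non-negative) cutoff. -/
theorem lowModes_mono {K K' : ℝ} (hK : 0 ≤ K) (hKK' : K ≤ K') :
    NeumannBox.lowModes K ⊆ NeumannBox.lowModes K' := by
  intro k hk
  rw [NeumannBox.mem_lowModes hK] at hk
  rw [NeumannBox.mem_lowModes (hK.trans hKK')]
  exact ⟨hk.1, hk.2.trans (by nlinarith)⟩

/-- The infrared mass is monotone in the cutoff. -/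
theorem irMass_mono {K K' L : ℝ} (hK : 0 ≤ K) (hKK' : K ≤ K') (N : ℕ) (Ψ : Config N → ℂ) :
    irMass K L N Ψ ≤ irMass K' L N Ψ :=
  Finset.sum_le_sum_of_subset (Finset.insert_subset_insert _ (lowModes_mono hK hKK'))

/-- The side of the thermodynamic box is non-negative. -/
theorem sideLength_nonneg (ρ : ℝ) (hρ : 0 ≤ ρ) (N : ℕ) : 0 ≤ BoseGas.sideLength ρ N := by
  unfold BoseGas.sideLength
  exact Real.rpow_nonneg (div_nonneg N.cast_nonneg hρ) _

/-- **Composition of the line** (proved): UV capture below `Λ₁` and vacancy of the phonon window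
`(Λ, Λ₁]` give capture `≥ (3/4 - w)N` below every `Λ > 0` — the crux `InfraredCapture`. -/
theorem infraredCapture_glue
    (hu : ∀ v : ℝ → ENNReal, BoseGas.IsRepulsiveFiniteRange v → ∃ ρ₀ : ℝ, 0 < ρ₀ ∧ ∀ ρ : ℝ, 0 < ρ → ρ < ρ₀ →
      ∃ Λ₁ κ : ℝ, 0 < Λ₁ ∧ 0 < κ ∧ ∀ᶠ N : ℕ in Filter.atTop,
        ∀ Ψ : BoseGas.TrialState N (BoseGas.sideLength ρ N),
          BoseGas.energy v Ψ ≤ BoseGas.groundStateEnergy v N (BoseGas.sideLength ρ N) +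
              ENNReal.ofReal (κ * N / BoseGas.sideLength ρ N ^ 2) →
            ENNReal.ofReal (3 / 4 * N) ≤
              irMass (Λ₁ * BoseGas.sideLength ρ N) (BoseGas.sideLength ρ N) N Ψ.ψ)
    (hw : ∀ v : ℝ → ENNReal, BoseGas.IsRepulsiveFiniteRange v → ∃ ρ₀ : ℝ, 0 < ρ₀ ∧ ∀ ρ : ℝ, 0 < ρ → ρ < ρ₀ →
      ∀ Λ₁ : ℝ, 0 < Λ₁ → ∃ w κ : ℝ, 0 ≤ w ∧ w < 3 / 4 ∧ 0 < κ ∧ ∀ Λ : ℝ, 0 < Λ → Λ ≤ Λ₁ →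
        ∀ᶠ N : ℕ in Filter.atTop, ∀ Ψ : BoseGas.TrialState N (BoseGas.sideLength ρ N),
          BoseGas.energy v Ψ ≤ BoseGas.groundStateEnergy v N (BoseGas.sideLength ρ N) +
              ENNReal.ofReal (κ * N / BoseGas.sideLength ρ N ^ 2) →
            irMass (Λ₁ * BoseGas.sideLength ρ N) (BoseGas.sideLength ρ N) N Ψ.ψ ≤
              irMass (Λ * BoseGas.sideLength ρ N) (BoseGas.sideLength ρ N) N Ψ.ψ +
                ENNReal.ofReal (w * N)) :
  ∀ v : ℝ → ENNReal, BoseGas.IsRepulsiveFiniteRange v → ∃ ρ₀ : ℝ, 0 < ρ₀ ∧ ∀ ρ : ℝ, 0 < ρ → ρ < ρ₀ →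
    ∃ c κ : ℝ, 0 < c ∧ 0 < κ ∧ ∀ Λ : ℝ, 0 < Λ → ∀ᶠ N : ℕ in Filter.atTop,
      ∀ Ψ : BoseGas.TrialState N (BoseGas.sideLength ρ N),
        BoseGas.energy v Ψ ≤ BoseGas.groundStateEnergy v N (BoseGas.sideLength ρ N) +
            ENNReal.ofReal (κ * N / BoseGas.sideLength ρ N ^ 2) →
          ENNReal.ofReal (c * N) ≤
            ∑ k ∈ insert (0 : Fin 3 → ℕ) (NeumannBox.lowModes (Λ * BoseGas.sideLength ρ N)),
              BoseGas.cellOccupation N (BoseGas.sideLength ρ N)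
                (fun x => ((NeumannBox.mode (BoseGas.sideLength ρ N) k x : ℝ) : ℂ)) Ψ.ψ := by
  intro v hv
  obtain ⟨ρ₁, hρ₁, Hu⟩ := hu v hv
  obtain ⟨ρ₂, hρ₂, Hw⟩ := hw v hv
  refine ⟨min ρ₁ ρ₂, lt_min hρ₁ hρ₂, fun ρ hρ hρlt => ?_⟩
  obtain ⟨Λ₁, κu, hΛ₁, hκu, Hu'⟩ := Hu ρ hρ (hρlt.trans_le (min_le_left _ _))
  obtain ⟨w, κw, hw0, hw34, hκw, Hw'⟩ := Hw ρ hρ (hρlt.trans_le (min_le_right _ _)) Λ₁ hΛ₁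
  refine ⟨3 / 4 - w, min κu κw, by linarith, lt_min hκu hκw, fun Λ hΛ => ?_⟩
  -- slack monotonicity, once and for all
  have hmono : ∀ (N : ℕ) (Ψ : BoseGas.TrialState N (BoseGas.sideLength ρ N)) (κ' : ℝ), min κu κw ≤ κ' →
      BoseGas.energy v Ψ ≤ BoseGas.groundStateEnergy v N (BoseGas.sideLength ρ N) +
        ENNReal.ofReal (min κu κw * N / BoseGas.sideLength ρ N ^ 2) →
      BoseGas.energy v Ψ ≤ BoseGas.groundStateEnergy v N (BoseGas.sideLength ρ N) +
        ENNReal.ofReal (κ' * N / BoseGas.sideLength ρ N ^ 2) := by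
    intro N Ψ κ' hκ' hΨ
    refine hΨ.trans (add_le_add le_rfl (ENNReal.ofReal_le_ofReal ?_))
    have hNL : 0 ≤ (N : ℝ) / BoseGas.sideLength ρ N ^ 2 := div_nonneg N.cast_nonneg (sq_nonneg _)
    calc min κu κw * N / BoseGas.sideLength ρ N ^ 2
        = min κu κw * (N / BoseGas.sideLength ρ N ^ 2) := by ring
      _ ≤ κ' * (N / BoseGas.sideLength ρ N ^ 2) := mul_le_mul_of_nonneg_right hκ' hNL
      _ = κ' * N / BoseGas.sideLength ρ N ^ 2 := by ring
  have hsplit : ∀ N : ℕ, ENNReal.ofReal (3 / 4 * N) =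
      ENNReal.ofReal ((3 / 4 - w) * N) + ENNReal.ofReal (w * N) := by
    intro N
    rw [← ENNReal.ofReal_add (by nlinarith [N.cast_nonneg (α := ℝ)]) (by positivity)]
    congr 1; ring
  by_cases hΛΛ₁ : Λ ≤ Λ₁
  · -- inside the UV scale: UV capture below `Λ₁`, then empty the window `(Λ, Λ₁]`
    filter_upwards [Hu', Hw' Λ hΛ hΛΛ₁] with N hN₁ hN₂ Ψ hΨ
    have hA := hN₁ Ψ (hmono N Ψ κu (min_le_left _ _) hΨ)
    have hB := hN₂ Ψ (hmono N Ψ κw (min_le_right _ _) hΨ)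
    have key : ENNReal.ofReal ((3 / 4 - w) * N) + ENNReal.ofReal (w * N) ≤
        irMass (Λ * BoseGas.sideLength ρ N) (BoseGas.sideLength ρ N) N Ψ.ψ + ENNReal.ofReal (w * N) := by
      rw [← hsplit]; exact hA.trans hB
    exact (ENNReal.add_le_add_iff_right ENNReal.ofReal_ne_top).1 key
  · -- beyond the UV scale the family only grows
    replace hΛΛ₁ : Λ₁ < Λ := not_le.1 hΛΛ₁
    filter_upwards [Hu'] with N hN₁ Ψ hΨ
    have hA := hN₁ Ψ (hmono N Ψ κu (min_le_left _ _) hΨ)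
    have hL := sideLength_nonneg ρ hρ.le N
    calc ENNReal.ofReal ((3 / 4 - w) * N)
        ≤ ENNReal.ofReal (3 / 4 * N) := ENNReal.ofReal_le_ofReal (by nlinarith [N.cast_nonneg (α := ℝ)])
      _ ≤ irMass (Λ₁ * BoseGas.sideLength ρ N) (BoseGas.sideLength ρ N) N Ψ.ψ := hA
      _ ≤ irMass (Λ * BoseGas.sideLength ρ N) (BoseGas.sideLength ρ N) N Ψ.ψ :=
          irMass_mono (mul_nonneg hΛ₁.le hL) (mul_le_mul_of_nonneg_right hΛΛ₁.le hL) N Ψ.ψ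

/-- The line concludes the crux BY NAME from its two registered stubs. -/
theorem InfraredCapture_of : Summit.AtomisticToContinuum.BoseEinsteinCondensation.Theses.BECJosephsonSlackThreshold.InfraredCapture :=
  infraredCapture_glue stub_uvCapture stub_infraredWindow

end Summit.AtomisticToContinuum.BoseEinsteinCondensation.Cruxes.InfraredCapture.InfraredWindow
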